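import Summits.BirchSwinnertonDyer.BirchSwinnertonDyer.Theorems.UniversalToricDescentLayerSelmerInjection
import Literature.NumberTheory.EllipticCurves.HeegnerModuleIndex
import HarnessLib

/-!
# Route UniversalToricDescent — `Sel_p(E/L) = ι⁻¹ Sel_{p^∞}(E/L)`: the mod-`p` Kummer Selmer group over `L = K̄^H` is the preimage of the
# `p^∞`-Selmer group under `(E[p] ↪ E[p^∞])_*`; hence the layer bound `#Sel_p(E/K_n) ≤ #Sel_{p^∞}(E/K_∞)[p]^{Γ_n}`
# (input `hS` of `…ResidualLinkOfLayerCount`, p739980; port stub `stub_residualLinkMult`, line `beta-road` v5, crux stmt-BirchSwinnertonDyer-24737)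

Lead prover bsd-wall-utd-p1 g23 (`--supports stmt-BirchSwinnertonDyer-24737`). Γ_K-world only.
* `localResTorsionOverOfEmb_eq_localResOverOfEmb_comp` — the local restriction of `H¹(H, E[m])` to `H¹(H_E, E(K̄_E))` factors through
  `(E[p] ↪ E[p^∞])_* = torsionToPrimaryH1Sub` (maps of composable compatible pairs, `resH1Hom_comp`);
* **`selmerTorsionOver_eq_comap_selmerGroupOver`** — `selmerTorsionOver H p = (selmerGroupOver p H).comap (torsionToPrimaryH1Sub p H)`
  (the two definitions use the same embeddings `closureEmb` at every finite and infinite place);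
* **`natCard_selmerTorsionOver_layer_le`** — with `…LayerSelmerInjection.natCard_layerSelmerTorsion_le` (p739348): under `E(K_∞)[p] = 0`,
  `Sel_p(E/K_n)` is finite and `#Sel_p(E/K_n) ≤ #{s ∈ Sel_{p^∞}(E/K_∞) : p s = 0, conj_{γ^{pⁿ}} s = s}` — so the research stub K2_res of
  beta-road v5 delivers the hypothesis `hS` of `…ResidualLinkOfLayerCount.residual_finite_of_twoSidedLayerCount` verbatim.

THEOREMS ONLY (no definition, no named fact, no `sorry`). BSD is not advanced by this file.
References: [PerrinRiou1987BSMF] §0 p. 401 (`Sel^{(pⁿ)}(E/L) = ker(H¹(L, E_{pⁿ}) → ∏_v H¹(L_v, E))`); [GreenbergLNM1716] §2, §3 Lemma 3.1.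
-/

set_option linter.dupNamespace false
set_option autoImplicit false

noncomputable section

open scoped Classical

namespace Summit.BirchSwinnertonDyer.BirchSwinnertonDyer.Theorems.UniversalToricDescentSelmerTorsionOverComap

open Field NumberField IsDedekindDomain Literature.NumberTheory.EllipticCurves Literature.NumberTheory.GaloisRepresentations
  WeierstrassCurve
open Summit.BirchSwinnertonDyer.BirchSwinnertonDyer.Theorems.UniversalToricDescentLayerSelmerInjection

universe u

section Local

variable {K : Type u} [Field K] (W : WeierstrassCurve K) (p : ℕ) [Fact p.Prime] (H : Subgroup (absoluteGaloisGroup K))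
  {E : Type u} [Field E] [Algebra K E] (ι : AlgebraicClosure K →ₐ[K] AlgebraicClosure E)

omit [Fact p.Prime] in
/-- The `E[p]`-local restriction is the `E[p^∞]`-local restriction after `(E[p] ↪ E[p^∞])_*` (composable compatible pairs).
[cite: PerrinRiou1987BSMF, §0 p. 401] -/
theorem localResTorsionOverOfEmb_eq_localResOverOfEmb_comp :
    W.localResTorsionOverOfEmb (p : ℤ) H ι = (W.localResOverOfEmb p H ι).comp (W.torsionToPrimaryH1Sub p H) := by
  rw [WeierstrassCurve.localResTorsionOverOfEmb, WeierstrassCurve.localResOverOfEmb, WeierstrassCurve.torsionToPrimaryH1Sub,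
    resH1Hom_comp]
  exact resH1Hom_congr (by ext; rfl) (by ext; rfl) _ _

end Local

section Global

variable {K : Type u} [Field K] [NumberField K] (W : WeierstrassCurve K) (p : ℕ) [Fact p.Prime]
  (H : Subgroup (absoluteGaloisGroup K)) [H.Normal]

omit [Fact p.Prime] in
/-- **`Sel_p(E/L) = ι⁻¹ Sel_{p^∞}(E/L)`**: `selmerTorsionOver H p = (selmerGroupOver p H).comap (torsionToPrimaryH1Sub p H)`.
[cite: PerrinRiou1987BSMF, §0 p. 401] [cite: GreenbergLNM1716, §2] -/
theorem selmerTorsionOver_eq_comap_selmerGroupOver :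
    W.selmerTorsionOver H (p : ℤ) = (W.selmerGroupOver p H).comap (W.torsionToPrimaryH1Sub p H) := by
  ext y
  simp only [WeierstrassCurve.selmerTorsionOver, WeierstrassCurve.selmerGroupOver, AddSubgroup.mem_comap, AddSubgroup.mem_inf,
    AddSubgroup.mem_iInf, AddMonoidHom.mem_ker, WeierstrassCurve.localKerOver, WeierstrassCurve.localResOver,
    WeierstrassCurve.conjH1_torsionToPrimaryH1Sub, localResTorsionOverOfEmb_eq_localResOverOfEmb_comp, AddMonoidHom.comp_apply]
  exact Iff.rfl

end Global

section Layer

variable {K : Type} [Field K] [NumberField K] (W : WeierstrassCurve K) {p : ℕ} [hp : Fact p.Prime] (κ : ZpExtension K p)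

/-- **The layer bound for `Sel_p(E/K_n)`** (input `hS` of `…ResidualLinkOfLayerCount`): under `E(K_∞)[p] = 0` and finiteness of the
`K_∞`-side set, `Sel_p(E/K_n) = selmerTorsionOver (Γ_{K_n}) p` is finite and
`#Sel_p(E/K_n) ≤ #{s ∈ Sel_{p^∞}(E/K_∞) : p s = 0, conj_{γ^{pⁿ}} s = s}`. [cite: GreenbergLNM1716, §3 Lemma 3.1] [cite: GreenbergVatsal2000, §2 Prop. (2.8)] -/
theorem natCard_selmerTorsionOver_layer_le (n : ℕ) (γ : absoluteGaloisGroup K)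
    (h0 : ∀ m : W.geomPrimaryTorsion p, (∀ σ ∈ κ.kerSubgroup, σ • m = m) → m = 0)
    (hfin : Set.Finite {s : W.selmerInfty κ |
      p • s = 0 ∧ W.conjH1 p κ.kerSubgroup (γ ^ p ^ n) (s : W.subgroupH1 p κ.kerSubgroup) = s}) :
    (W.selmerTorsionOver (κ.layerSubgroup n) (p : ℤ) : Set (W.torsionH1Over (p : ℤ) (κ.layerSubgroup n))).Finite ∧
      Nat.card ↥(W.selmerTorsionOver (κ.layerSubgroup n) (p : ℤ)) ≤
        Nat.card {s : W.selmerInfty κ |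
          p • s = 0 ∧ W.conjH1 p κ.kerSubgroup (γ ^ p ^ n) (s : W.subgroupH1 p κ.kerSubgroup) = s} := by
  have h := natCard_layerSelmerTorsion_le W κ n γ h0 hfin
  have e : (W.selmerTorsionOver (κ.layerSubgroup n) (p : ℤ) : Set (W.torsionH1Over (p : ℤ) (κ.layerSubgroup n))) =
      {y : subgroupH1 (κ.layerSubgroup n) (W.geomTorsion (p : ℤ)) |
        W.torsionToPrimaryH1Sub p (κ.layerSubgroup n) y ∈ W.selmerLayer κ n} := by
    rw [selmerTorsionOver_eq_comap_selmerGroupOver]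
    rfl
  refine ⟨e ▸ h.1, ?_⟩
  have e2 : Nat.card ↥(W.selmerTorsionOver (κ.layerSubgroup n) (p : ℤ)) =
      Nat.card {y : subgroupH1 (κ.layerSubgroup n) (W.geomTorsion (p : ℤ)) |
        W.torsionToPrimaryH1Sub p (κ.layerSubgroup n) y ∈ W.selmerLayer κ n} := by
    rw [← e]; rfl
  rw [e2]
  exact h.2

end Layer

end Summit.BirchSwinnertonDyer.BirchSwinnertonDyer.Theorems.UniversalToricDescentSelmerTorsionOverComap

end
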